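import Literature.NumberTheory.Automorphic.UnitaryGroupIsotropicFrameAction       -- ★ the frame chart's `variable` block, `hermForm` algebra, `IsQuadraticCoordinates`
import HarnessLib

/-!
# Crux `H413`, programme P2, N3 road (S2)-b part 2a — THE STABILISER OF THE LINE IN THE FRAME CHART, BY ITS ACTION ON THE FRAME:
# an isometry `g` with `g⁻¹ x₀ = x₀`, `g⁻¹ bⱼ ∈ bⱼ + S x₀` is `Y^⊥`-trivial; with `g⁻¹ y₀ = y₀ + μ x₀`, `σ μ = φ(t) δ` it is the Siegel unipotent
# `unipotentσ (t • c)` of the norm chirp; an isometry with `g⁻¹ x₀ = α x₀`, `g⁻¹ bⱼ = νⱼ bⱼ` maps `Y` into `Y`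

Cell hodgecm-mathlib (D-0151), FLOOR 0, crux item H413 = stmt-HodgeConjecture-24833, programme P2; N3 road (`F0/P2/B-p18/g28/N3-ROAD.v1.B-p18g28.md`)
§2 (S2), desk F0P2-plan (g8) 18:45:24Z «(S2)-b TRANSPORT».  Seat A-p12 (g17); sequel of part 1 `F0P2oParabolicLineChartDocking` (same seat).  THEOREMS ONLY
(no `def`, no instance, no notation, no named fact, no `sorry`); never imports a `Cruxes/…/Lines` module; kernel lane `--supports stmt-HodgeConjecture-24833
--as helper`.  HC_CM is proved only modulo the printed citations until rung 0 closes; nothing printed is asserted here.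

WHY THIS FORM.  Part 1 states the three hypotheses `hp` ∕ `hZ` ∕ `hq` of ★ p831043 ∕ ★ p831322 for the MATRICES `lineRoot` ∕ `lineDilation` of ★
`UnitaryGroupIsotropicLineElements`.  The N3 assembler, however, meets the Borel of `Gqs L v = U(Φ₃)(L⁺_v)` transported by a form congruence `T`
(★ `cmDatumLocalCongr`: `n ↦ T n T⁻¹`) and tensored with the line (★ `localLineInl`): identifying those with `lineRoot` matrices is avoidable.  What the
chart formula `Γv v = ((re B(x₀,v), im B(x₀,v)) ⊔ (aⱼ⁻¹ re B(bⱼ,v)) ; (im B(y₀,v), −re B(y₀,v)) ⊔ (im B(bⱼ,v)))` actually needs is only HOW `g⁻¹` MOVES THE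
FRAME `(x₀, y₀, bⱼ)` — because `B(x, g v) = B(g⁻¹ x, v)` for an isometry (§1 `hermForm_mulVec_eq_of_mem`).  For `n` upper unitriangular in the frame
`(T e₁, T e₂, T e₃) = (x₀, b₀, a y₀)`: `n⁻¹ x₀ = x₀`, `n⁻¹ b₀ ∈ b₀ + S x₀`, `n⁻¹ y₀ ∈ y₀ + S b₀ + S x₀` (first column ∕ upper triangularity), which is
all §2 asks:

* §1 `hermForm_mulVec_eq_of_mem` — the ADJOINT of an isometry is its inverse: `B(x, g v) = B(g⁻¹ x, v)` for `g ∈ U(σ, H)`.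
* §2 (frame chart `Γv`, hypotheses on an «adjoint» `g′` with `hadj : B(x, g v) = B(g′ x, v)`):
  **`exists_frameCoords_mulVec_eq_add`** — `g′ x₀ = x₀`, `g′ bⱼ = bⱼ + μⱼ x₀` ⇒ for `Γv v ∈ Y^⊥` (`(Γv v).1|_{Fin 2} = 0`): `Γv (g v) = Γv v + (0, (y₁, 0))`
  (= `hp` of ★ p831043: EVERY element of `N(ℓ)` — indeed of the stabiliser of `x₀` acting trivially on `x₀^⊥ ∕ S x₀` — is `Y^⊥`-trivial);
  **`frameCoords_mulVec_eq_unipotentσ`** — `g′ x₀ = x₀`, `g′ bⱼ = bⱼ`, `g′ y₀ = y₀ + μ x₀` with `σ μ = φ(t) δ` ⇒ `Γv (g v) = unipotentσ (t • c) (Γv v)` for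
  any linear `c` with `c x = (x₀′, −d x₁′) ⊔ 0` (= `hZ` of ★ p831322: the CENTRE `n_t` of `N(ℓ)`);
  **`exists_frameCoords_mulVec_eq_zero_inl`** — `g′ x₀ = α x₀`, `g′ bⱼ = νⱼ bⱼ` ⇒ `Γv v ∈ Y ⇒ Γv (g v) ∈ Y` (= `hq` of ★ p831043: the whole TORUS).
[MoeglinVignerasWaldspurger1987, Chap. 3 §IV.2; Kudla1986, proof of Thm. 2.8; Dieudonne1971GroupesClassiques, Chap. II §5.]

## References
* [MoeglinVignerasWaldspurger1987] C. Mœglin, M.-F. Vignéras, J.-L. Waldspurger, *Correspondances de Howe sur un corps p-adique*, LNM 1291 (1987): Chap. 3 §IV.2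
  (the parabolic of an isotropic subspace acts through the Siegel parabolic of `Sp` in the mixed model).
* [Kudla1986] S. Kudla, *On the local theta-correspondence*, Invent. Math. 83 (1986): proof of Thm. 2.8.
* [Dieudonne1971GroupesClassiques] J. Dieudonné, *La géométrie des groupes classiques* (1971): Chap. II §5.
-/

set_option autoImplicit false
set_option linter.dupNamespace false -- the mandated namespace repeats the single-problem summit's segment

open scoped MatrixGroups
open _root_.Matrix Literature.RepresentationTheory.HeisenbergGroup
open Literature.NumberTheory.Automorphic Literature.NumberTheory.Automorphic.UnitaryGroup
open Literature.NumberTheory.Automorphic.UnitaryGroup.QuadraticCoordinates Literature.NumberTheory.Automorphic.UnitaryGroup.IsQuadraticCoordinates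

namespace Summit.HodgeConjecture.HodgeConjecture.Cruxes.H413.F0P2oFrameStabiliserYTriviality

/-! ## §1 The adjoint of an isometry is its inverse -/

section Adjoint

variable {S : Type*} [CommRing S] (σ : S →+* S) {n : Type*} [Fintype n] [DecidableEq n] (H : Matrix n n S)

/-- **`B(x, g v) = B(g⁻¹ x, v)` for `g ∈ U(σ, H)`** (`B(g u, g v) = B(u, v)` at `u = g⁻¹ x`). [cite: Dieudonne1971GroupesClassiques, Chap. II §5] -/
theorem hermForm_mulVec_eq_of_mem {g : GL n S} (hg : g ∈ unitaryGroupOfForm σ H) (x v : n → S) :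
    hermForm σ H x ((g : Matrix n n S) *ᵥ v) = hermForm σ H (((g⁻¹ : GL n S) : Matrix n n S) *ᵥ x) v := by
  have h := (mem_unitaryGroupOfForm_iff_hermForm σ H g).1 hg (((g⁻¹ : GL n S) : Matrix n n S) *ᵥ x) v
  rw [Matrix.mulVec_mulVec, ← Units.val_mul, mul_inv_cancel, Units.val_one, Matrix.one_mulVec] at h
  exact h

end Adjoint

/-! ## §2 The stabiliser of the line in the frame chart -/

section Chart

variable {R S : Type*} [Field R] [CommRing S]
variable {φ : R →+* S} {Ψ : (R × R) ≃+ S} {δ : S} {d : R} (h : IsQuadraticCoordinates φ Ψ δ d)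
variable {n : Type*} [Fintype n] [DecidableEq n]
variable {T : Matrix n n R} {σ : S →+* S} {m : ℕ} {x₀ y₀ : n → S} {b : Fin m → n → S} {a : Fin m → R}
variable (Γv : (n → S) → ((Fin 2 ⊕ Fin m) → R) × ((Fin 2 ⊕ Fin m) → R))
variable (hΓ : ∀ v : n → S, Γv v =
  (Sum.elim ![re Ψ (hermForm σ (T.map φ) x₀ v), im Ψ (hermForm σ (T.map φ) x₀ v)]
      (fun j => (a j)⁻¹ * re Ψ (hermForm σ (T.map φ) (b j) v)),
    Sum.elim ![im Ψ (hermForm σ (T.map φ) y₀ v), -re Ψ (hermForm σ (T.map φ) y₀ v)]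
      (fun j => im Ψ (hermForm σ (T.map φ) (b j) v))))
variable (g g' : Matrix n n S) (hadj : ∀ x v : n → S, hermForm σ (T.map φ) x (g *ᵥ v) = hermForm σ (T.map φ) (g' *ᵥ x) v)

omit [DecidableEq n] in
include hΓ in
/-- the translation coordinates of the line vanish iff `B(x₀, v) = 0` (`λ = Ψ(re λ, im λ)`). [cite: MoeglinVignerasWaldspurger1987, Chap. 3 §IV.2] -/
theorem hermForm_left_eq_zero_of_inl_eq_zero (v : n → S) (hv : (Γv v).1 ∘ Sum.inl = 0) : hermForm σ (T.map φ) x₀ v = 0 := by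
  have h0 : (Γv v).1 (Sum.inl 0) = 0 := congr_fun hv 0
  have h1 : (Γv v).1 (Sum.inl 1) = 0 := congr_fun hv 1
  rw [hΓ] at h0 h1
  simp only [Sum.elim_inl, Matrix.cons_val_zero, Matrix.cons_val_one] at h0 h1
  rw [← apply_re_im Ψ (hermForm σ (T.map φ) x₀ v), h0, h1]
  exact map_zero Ψ

omit [DecidableEq n] in
include hΓ in
/-- in `Y = {x = 0, y|_{Fin m} = 0}` the pairings with `x₀` and every `bⱼ` vanish (`aⱼ ≠ 0`). [cite: MoeglinVignerasWaldspurger1987, Chap. 3 §IV.2] -/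
theorem hermForm_frame_eq_zero_of_eq_zero_inl (ha : ∀ j, a j ≠ 0) (v : n → S) {y₁ : Fin 2 → R} (hv : Γv v = (0, Sum.elim y₁ 0)) :
    hermForm σ (T.map φ) x₀ v = 0 ∧ ∀ j, hermForm σ (T.map φ) (b j) v = 0 := by
  rw [hΓ] at hv
  have h1 := congr_arg Prod.fst hv
  have h2 := congr_arg Prod.snd hv
  dsimp only at h1 h2
  have hx0 : re Ψ (hermForm σ (T.map φ) x₀ v) = 0 := by simpa using congr_fun h1 (Sum.inl 0)
  have hx1 : im Ψ (hermForm σ (T.map φ) x₀ v) = 0 := by simpa using congr_fun h1 (Sum.inl 1)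
  have hbr : ∀ j, re Ψ (hermForm σ (T.map φ) (b j) v) = 0 := fun j => by
    have := congr_fun h1 (Sum.inr j)
    simp only [Sum.elim_inr, Pi.zero_apply, mul_eq_zero, inv_eq_zero] at this
    exact this.resolve_left (ha j)
  have hbi : ∀ j, im Ψ (hermForm σ (T.map φ) (b j) v) = 0 := fun j => by simpa using congr_fun h2 (Sum.inr j)
  refine ⟨?_, fun j => ?_⟩
  · rw [← apply_re_im Ψ (hermForm σ (T.map φ) x₀ v), hx0, hx1]; exact map_zero Ψ
  · rw [← apply_re_im Ψ (hermForm σ (T.map φ) (b j) v), hbr j, hbi j]; exact map_zero Ψ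

include hΓ hadj in
/-- **THE STABILISER OF `x₀` ACTING TRIVIALLY ON `x₀^⊥ ∕ S x₀` IS `Y^⊥`-TRIVIAL** (`hp` of ★ p831043): if `g′ x₀ = x₀` and `g′ bⱼ = bⱼ + μⱼ x₀`, then for
`Γv v ∈ Y^⊥` the chart coordinates of `g v` and `v` differ only in the two modulation coordinates of the line — `Γv (g v) = Γv v + (0, (y₁, 0))`.
(For `n ∈ N(ℓ)` read in the frame `(T e₁, T e₂, T e₃)`: `n⁻¹` is upper unitriangular.) [cite: MoeglinVignerasWaldspurger1987, Chap. 3 §IV.2]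
[cite: Kudla1986, proof of Thm. 2.8] -/
theorem exists_frameCoords_mulVec_eq_add (hx0 : g' *ᵥ x₀ = x₀) (hb : ∀ j, ∃ μ : S, g' *ᵥ b j = b j + μ • x₀) (v : n → S)
    (hv : (Γv v).1 ∘ Sum.inl = 0) : ∃ y₁ : Fin 2 → R, Γv (g *ᵥ v) = Γv v + (0, Sum.elim y₁ 0) := by
  have hlam : hermForm σ (T.map φ) x₀ v = 0 := hermForm_left_eq_zero_of_inl_eq_zero Γv hΓ v hv
  have hx : hermForm σ (T.map φ) x₀ (g *ᵥ v) = hermForm σ (T.map φ) x₀ v := by rw [hadj, hx0]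
  have hbj : ∀ j, hermForm σ (T.map φ) (b j) (g *ᵥ v) = hermForm σ (T.map φ) (b j) v := fun j => by
    obtain ⟨μ, hμ⟩ := hb j
    rw [hadj, hμ, hermForm_add_left, hermForm_smul_left_eq, hlam, mul_zero, add_zero]
  refine ⟨fun i => (Γv (g *ᵥ v)).2 (Sum.inl i) - (Γv v).2 (Sum.inl i), Prod.ext ?_ (funext fun k => ?_)⟩
  · rw [Prod.fst_add, add_zero, hΓ, hΓ v]
    dsimp only
    rw [hx]
    exact congr_arg _ (funext fun j => by rw [hbj])
  · rcases k with i | j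
    · simp only [Prod.snd_add, Pi.add_apply, Sum.elim_inl]
      ring
    · simp only [Prod.snd_add, Pi.add_apply, Sum.elim_inr, Pi.zero_apply, add_zero]
      rw [hΓ, hΓ v]
      dsimp only
      rw [Sum.elim_inr, Sum.elim_inr, hbj]

include h hΓ hadj in
/-- **A TRANSVECTION OF THE LINE IS THE SIEGEL UNIPOTENT OF THE NORM CHIRP** (`hZ` of ★ p831322): if `g′ x₀ = x₀`, `g′ bⱼ = bⱼ` and `g′ y₀ = y₀ + μ x₀` with
`σ μ = φ(t) δ` (the centre `n_t` of `N(ℓ)`), then `Γv (g v) = unipotentσ (t • c) (Γv v)` for any linear `c` with `c x = (x₀′, −d x₁′) ⊔ 0`: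
only the modulation coordinates of the line move, by `(t x₀′, −t d x₁′)`. [cite: MoeglinVignerasWaldspurger1987, Chap. 3 §IV.2] [cite: Kudla1986, proof of Thm. 2.8] -/
theorem frameCoords_mulVec_eq_unipotentσ (hx0 : g' *ᵥ x₀ = x₀) (hb : ∀ j, g' *ᵥ b j = b j)
    {μ : S} {t : R} (hy0 : g' *ᵥ y₀ = y₀ + μ • x₀) (hμ : σ μ = φ t * δ)
    (c : ((Fin 2 ⊕ Fin m) → R) →ₗ[R] ((Fin 2 ⊕ Fin m) → R)) (hc : ∀ x : (Fin 2 ⊕ Fin m) → R, c x = Sum.elim ![x (Sum.inl 0), -d * x (Sum.inl 1)] 0)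
    (v : n → S) : Γv (g *ᵥ v) = unipotentσ (t • c) (Γv v) := by
  have hx : hermForm σ (T.map φ) x₀ (g *ᵥ v) = hermForm σ (T.map φ) x₀ v := by rw [hadj, hx0]
  have hbj : ∀ j, hermForm σ (T.map φ) (b j) (g *ᵥ v) = hermForm σ (T.map φ) (b j) v := fun j => by rw [hadj, hb j]
  have hy : hermForm σ (T.map φ) y₀ (g *ᵥ v) = hermForm σ (T.map φ) y₀ v + φ t * δ * hermForm σ (T.map φ) x₀ v := by
    rw [hadj, hy0, hermForm_add_left, hermForm_smul_left_eq, hμ]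
  -- the translation coordinates of the line `λ = B(x₀, v) = Ψ(x₀′, x₁′)`
  have hl0 : (Γv v).1 (Sum.inl 0) = re Ψ (hermForm σ (T.map φ) x₀ v) := by rw [hΓ]; simp
  have hl1 : (Γv v).1 (Sum.inl 1) = im Ψ (hermForm σ (T.map φ) x₀ v) := by rw [hΓ]; simp
  have hre : re Ψ (φ t * δ) = 0 := by rw [h.re_mul, h.re_map, h.im_map, h.re_delta, h.im_delta]; ring
  have him : im Ψ (φ t * δ) = t := by rw [h.im_mul, h.re_map, h.im_map, h.re_delta, h.im_delta]; ring
  rw [unipotentσ_apply, LinearMap.smul_apply, hc, hl0, hl1]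
  conv_lhs => rw [hΓ]
  conv_rhs => rw [hΓ v]
  dsimp only
  rw [hx, hy]
  refine Prod.ext (funext fun k => ?_) (funext fun k => ?_)
  · rcases k with i | j
    · rfl
    · simp only [Sum.elim_inr, hbj]
  · rcases k with i | j
    · fin_cases i
      · simp [h.im_mul (φ t * δ), hre, him]
      · simp [h.re_mul (φ t * δ), hre, him]
        ring
    · simp [hbj]

include hΓ hadj in
/-- **AN ISOMETRY STABILISING THE LINE AND EACH LINE `S bⱼ` MAPS `Y` INTO `Y`** (`hq` of ★ p831043 for the whole diagonal torus
`d(α, β, (σα)⁻¹)` of `U(Φ₃)` — `g′ x₀ = α′ x₀`, `g′ b₀ = β′ b₀` — and for `U(V₁) × U(W)`): if `g′ x₀ = α x₀` and `g′ bⱼ = νⱼ bⱼ`, then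
`Γv v ∈ Y ⇒ Γv (g v) ∈ Y` (no hypothesis on `g′ y₀`). [cite: MoeglinVignerasWaldspurger1987, Chap. 3 §IV.2] -/
theorem exists_frameCoords_mulVec_eq_zero_inl (ha : ∀ j, a j ≠ 0) {α : S} (hx0 : g' *ᵥ x₀ = α • x₀)
    (hb : ∀ j, ∃ ν : S, g' *ᵥ b j = ν • b j) (v : n → S) {y₁ : Fin 2 → R} (hv : Γv v = (0, Sum.elim y₁ 0)) :
    ∃ y₁' : Fin 2 → R, Γv (g *ᵥ v) = (0, Sum.elim y₁' 0) := by
  obtain ⟨hxv, hbv⟩ := hermForm_frame_eq_zero_of_eq_zero_inl Γv hΓ ha v hv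
  have hx : hermForm σ (T.map φ) x₀ (g *ᵥ v) = 0 := by rw [hadj, hx0, hermForm_smul_left_eq, hxv, mul_zero]
  have hbj : ∀ j, hermForm σ (T.map φ) (b j) (g *ᵥ v) = 0 := fun j => by
    obtain ⟨ν, hν⟩ := hb j
    rw [hadj, hν, hermForm_smul_left_eq, hbv j, mul_zero]
  refine ⟨(Γv (g *ᵥ v)).2 ∘ Sum.inl, Prod.ext ?_ ?_⟩
  · rw [hΓ]
    dsimp only
    funext k
    rcases k with i | j
    · fin_cases i
      · simp [hx]
      · simp [hx]
    · simp [hbj]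
  · change (Γv (g *ᵥ v)).2 = Sum.elim ((Γv (g *ᵥ v)).2 ∘ Sum.inl) 0
    conv_lhs => rw [← Sum.elim_comp_inl_inr (Γv (g *ᵥ v)).2]
    congr 1
    funext j
    rw [Function.comp_apply, hΓ]
    dsimp only
    rw [Sum.elim_inr, hbj, map_zero]
    rfl

end Chart

end Summit.HodgeConjecture.HodgeConjecture.Cruxes.H413.F0P2oFrameStabiliserYTriviality
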